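import Summits.ResolutionOfSingularities.ResolutionOfSingularities.Theorems.WeightedInvariantP3aTieFreeDegenerate
import Summits.ResolutionOfSingularities.ResolutionOfSingularities.Theorems.WeightedInvariantIota3Tie
import Summits.ResolutionOfSingularities.ResolutionOfSingularities.Theorems.WeightedInvariantContactLevelQuotient
import Literature.AlgebraicGeometry.Resolution.RegularLocalOrderValuation
import HarnessLib

/-!
# A TIE produces a no-drop successor over the closed point (converse of res-type-092's Lemma B) — door
# `HypersurfaceCentreConstruction` (stmt-ResolutionOfSingularities-19897), route `WeightedInvariant`, P3 rung `KeyRungGrLE 3 p`,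
# clause (c8)≤3,p for the letter `τ` (finiteness of the tie points, the one algebra lemma of the in-chart step)

[OURS · L1 W4.3 · cell `res-hironaka`, HUMAN RULING D-0089] Helper file `--supports stmt-ResolutionOfSingularities-19897` (line
`local-engine` of res-L1-w43-plan-1, RULING gen 11 #5 «(D2) FINITENESS OF TIE POINTS: route = Chevalley + generic drop», spec
`L/res-type-047/D2-INCHART-SPEC.md` §3).  res-type-092's `LocalGameEFTCylinder.not_mem_pow_of_notMem_steepened` («Lemma B»,
`…P3aTieCurve`) and `notMem_pow_transform_of_tieFree` (`…P3aTieFreeDrop`) prove: NO tie ⇒ the order DROPS at every successor of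
the P3a cylinder move over the closed point.  This file proves the CONVERSE, which the Chevalley argument for the finiteness of the
tie points needs («the constructible no-drop set catches every tie point», spec §2 (S5)):

SETTING (as in `…P3aTieCurve`): `S` regular local, `(y, x, z)` a regular system of parameters, `P = (y, x)` prime, `z ∉ P`,
`B = S[t⁻¹, 𝒥ₙ((y,x); w) tⁿ]` with charts `ρ` (`ker ρ = (t⁻¹)`) and `ρ₀ : B ↠ κ[X₀, X₁]` (`ker ρ₀ = (t⁻¹, z)`); a second regular
system `(a₁, a₂, z)` with `a₁ = (t⁻¹)^{e₁} V₁`, `a₂ = (t⁻¹)^{e₂} W` in `B`, `ρ₀ W = Xᵢ - μ Xⱼ^r` (`i ≠ j`): the TIE CURVE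
`C₀ = V(t⁻¹, z, W)` of the special fibre.
* §1 `map_mem_pow_of_mem_steepened` (pure algebra): `f ∈ 𝒥ₘ((a₁, a₂, z); (e₁, e₂ + 1, 1))` ⇒ `φ f ∈ 𝔫^m` for every ring map `φ`
  with `φ a₁ = t^{e₁} V₁`, `φ a₂ = t^{e₂} W` and every ideal `𝔫 ∋ t, φ z, W` (no intersection lemma is needed).
* §2 `mem_pow_sub_of_pow_mul_mem` (`t ∈ 𝔪 ∖ 𝔪²`, `tᵃ g ∈ 𝔪^m ⇒ g ∈ 𝔪^{m-a}` in a regular local ring: `adicOrder_mul`),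
  `not_mem_sq_of_span_range_eq` (a member of a regular system of parameters is not in `𝔪²`).
* §3 **`mem_pow_of_mem_steepened`** (Lemma B′): at EVERY prime `𝔫 ⊇ (t⁻¹, z, W)` of `B`, `f ∈ 𝒥ₘ((a₁, a₂, z); (e₁, e₂ + 1, 1))`
  and `f = (t⁻¹)ᵃ g` give `g/1 ∈ 𝔪_{B_𝔫}^{m - a}` (`B_𝔫` is regular with parameters `(t⁻¹, z, W[, p̃])`, res-type-092's
  `exists_rsp_of_mem`).
* §4 `exists_prime_tieCurve` (the generic point of `C₀` is a prime of `B` off `Xⱼ = 0`), `comap_eq_maximalIdeal_of_mem`.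
* §5 **`exists_successor_mem_pow_of_tie`** / `…_of_tie_swap`: for the P3a datum `(y, x; r, q)`, `0 < q ≤ r`, the tie membership
  `f ∈ 𝒥_{(r+1)ν}((x, y - λx^r, z); (q, r+1, 1))` (resp. `q = r = 1`, `f ∈ 𝒥_{2ν}((y, x, z); (1, 2, 1))`) and `f = (t⁻¹)^{rν} g`
  give a prime `𝔫 ∋ t⁻¹, z` of `B` over `𝔪_S` with `X ∉ 𝔫` (resp. `Y ∉ 𝔫`) and `g/1 ∈ 𝔪_{B_𝔫}^ν`: the order does NOT drop.
* §6 `Iota3.IsTiePresentation.exists_successor_le_adicOrder` — the same read off res-type-092's `Iota3.IsTiePresentation`.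

[OURS] Replaces the role of NO printed item; NOT a statement of the manuscript under review [claim: Hironaka2017, status:
under-review].  AI work, weaker than expert review.  Def-free.

## References

* D. Abramovich, M. H. Quek, B. Schober, *Torus actions, weighted blow-ups, and desingularization of plane curves*,
  arXiv:2507.01232 (v3, 2026), Thm 1.3 (3), §5 (the successors over the closed point). [AbramovichQuekSchober2025]
* J. Włodarczyk, *Functorial resolution by torus actions*, arXiv:2203.03090, §2.3.9, §3.3 (the local equations
  `uᵢ = (t⁻¹)^{wᵢ} uᵢ'` of the full cobordant blow-up). [Wlodarczyk2022]
* O. Zariski, P. Samuel, *Commutative Algebra* II, Ch. VIII §1 Thm. 1 (the order of a regular local ring is a valuation).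
  [ZariskiSamuel1960]
-/

noncomputable section

set_option linter.dupNamespace false -- mandated namespace `Summit.<Summit>.<Problem>` of this single-conjunct summit

open IsLocalRing Literature.AlgebraicGeometry.Resolution
open Summit.ResolutionOfSingularities.ResolutionOfSingularities.Theorems
open Summit.ResolutionOfSingularities.ResolutionOfSingularities.Theorems.LocalGameEFTCylinder

namespace Summit.ResolutionOfSingularities.ResolutionOfSingularities.Cruxes.HypersurfaceCentreConstruction.LocalEngine
namespace TieFinite
/-! ## §1 A steepened monomial membership pushes into the powers of every ideal containing `(t, z, W)` -/
section Push
variable {S : Type} [CommRing S] {B : Type} [CommRing B]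
/-- **Pure algebra.**  `φ : S → B` a ring map with `φ a₁ = t^{e₁} V₁`, `φ a₂ = t^{e₂} W`; `𝔫` an ideal of `B` containing `t`,
`φ z` and `W`.  If `f ∈ 𝒥ₘ((a₁, a₂, z); (e₁, e₂ + 1, 1))` then `φ f ∈ 𝔫^m`: the monomial `a₁^{α₀} a₂^{α₁} z^{α₂}` of weight
`e₁α₀ + (e₂+1)α₁ + α₂ ≥ m` maps to `φ(c) V₁^{α₀} · t^{e₁α₀ + e₂α₁} (φ z)^{α₂} W^{α₁} ∈ 𝔫^{e₁α₀ + e₂α₁ + α₂ + α₁}`.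
[cite: Wlodarczyk2022, §3.3] -/
theorem map_mem_pow_of_mem_steepened (φ : S →+* B) {a₁ a₂ z : S} {t V₁ W : B} {e₁ e₂ : ℕ} (h₁ : φ a₁ = t ^ e₁ * V₁)
    (h₂ : φ a₂ = t ^ e₂ * W) (𝔫 : Ideal B) (ht : t ∈ 𝔫) (hz : φ z ∈ 𝔫) (hW : W ∈ 𝔫) {f : S} {m : ℕ}
    (hf : f ∈ weightedMonomialIdeal ![a₁, a₂, z] ![e₁, e₂ + 1, 1] m) : φ f ∈ 𝔫 ^ m := by
  classical
  obtain ⟨l, hl, hfl⟩ := exists_finsupp_of_mem_weightedMonomialIdeal ![a₁, a₂, z] ![e₁, e₂ + 1, 1] hf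
  rw [hfl, map_expansion_eq φ h₁ h₂ rfl l.support (fun α => l α)]
  refine Ideal.sum_mem _ fun α hα => Ideal.mul_mem_left _ _ ?_
  have hwt : m ≤ e₁ * α 0 + e₂ * α 1 + α 2 + α 1 := by
    have h := hl α hα
    rw [Fin.sum_univ_three] at h
    simp only [Matrix.cons_val_zero, Matrix.cons_val_one, Matrix.cons_val] at h
    linarith
  refine Ideal.pow_le_pow_right hwt ?_
  rw [pow_add, pow_add]
  exact Ideal.mul_mem_mul (Ideal.mul_mem_mul (Ideal.pow_mem_pow ht _) (Ideal.pow_mem_pow hz _)) (Ideal.pow_mem_pow hW _)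
end Push

/-! ## §2 Order bookkeeping in a regular local ring -/
section Order
variable {L : Type} [CommRing L]
/-- **`tᵃ g ∈ 𝔪^m ⇒ g ∈ 𝔪^{m - a}`** for `t ∈ 𝔪 ∖ 𝔪²` in a regular local ring (the `𝔪`-adic order is a valuation:
`ord (tᵃ g) = a + ord g`). [cite: ZariskiSamuel1960, Ch. VIII §1 Thm. 1] -/
theorem mem_pow_sub_of_pow_mul_mem [IsRegularLocalRing L] {t g : L} (ht : t ∈ maximalIdeal L)
    (ht2 : t ∉ maximalIdeal L ^ 2) {a m : ℕ} (h : t ^ a * g ∈ maximalIdeal L ^ m) :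
    g ∈ maximalIdeal L ^ (m - a) := by
  have hord : adicOrder t = 1 := (adicOrder_eq_one_iff t).mpr ⟨ht, ht2⟩
  have hle : (m : ℕ∞) ≤ adicOrder (t ^ a * g) := (le_adicOrder_iff _ m).mpr h
  rw [adicOrder_mul, adicOrder_pow, hord, mul_one] at hle
  rw [← le_adicOrder_iff]
  rcases eq_or_ne (adicOrder g) ⊤ with htop | hne
  · rw [htop]; exact le_top
  · obtain ⟨n, hn⟩ := ENat.ne_top_iff_exists.mp hne
    rw [← hn] at hle ⊢
    have hle' : m ≤ a + n := by exact_mod_cast hle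
    exact_mod_cast (show m - a ≤ n by omega)

/-- **A member of a regular system of parameters is not in `𝔪²`**: `L` local Noetherian of Krull dimension `k`, `u : Fin k → L`
with `(u) = 𝔪`; then `uᵢ ∉ 𝔪²` (Nakayama + Krull, `ContactLevel.not_mem_sq_of_span_insert_eq`). [cite: ZariskiSamuel1960, Ch. VIII §1] -/
theorem not_mem_sq_of_span_range_eq [IsLocalRing L] [IsNoetherianRing L] {k : ℕ} (u : Fin k → L)
    (hu : Ideal.span (Set.range u) = maximalIdeal L) (hdim : ringKrullDim L = k) (i : Fin k) :
    u i ∉ maximalIdeal L ^ 2 := by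
  classical
  have hfin : (Set.range u \ {u i}).Finite := (Set.finite_range u).sdiff
  refine ContactLevel.not_mem_sq_of_span_insert_eq hfin ?_ ?_
  · rw [Set.insert_sdiff_singleton, Set.insert_eq_of_mem (Set.mem_range_self i), hu]
  · rw [hdim, Set.ncard_sdiff_singleton_of_mem (Set.mem_range_self i)]
    have hcard : (Set.range u).ncard ≤ k := by
      rw [← Set.image_univ]
      refine (Set.ncard_image_le Set.finite_univ).trans ?_
      rw [Set.ncard_univ, Nat.card_eq_fintype_card, Fintype.card_fin]
    have hpos : 0 < (Set.range u).ncard := (Set.ncard_pos (Set.finite_range u)).mpr ⟨u i, Set.mem_range_self i⟩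
    have hlt : (Set.range u).ncard - 1 < k := by omega
    exact_mod_cast hlt
end Order

/-! ## §3 Lemma B′: on the tie curve the transform keeps order `≥ m - a` -/
section LemmaB'
variable {S : Type} [CommRing S] [IsRegularLocalRing S] {y x z : S} {w : Fin 2 → ℕ}
/-- **Lemma B′ (converse of res-type-092's Lemma B).**  `S` regular local, `P = (y, x)` prime, `z ∉ P`;
`B = S[t⁻¹, 𝒥ₙ((y,x); w) tⁿ]` with charts `ρ` (`ker ρ = (t⁻¹)`, `ρ a = ā`) and `ρ₀` (`ker ρ₀ = (t⁻¹, z)`, onto `κ[X₀,X₁]`,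
`κ` a field); `a₁ = (t⁻¹)^{e₁} V₁`, `a₂ = (t⁻¹)^{e₂} W` in `B` with `ρ₀ W = Xᵢ - μ Xⱼ^r` (`i ≠ j`).  Let `𝔫` be ANY prime of `B`
with `t⁻¹, z, W ∈ 𝔫` (a point of the tie curve).  If `f ∈ 𝒥ₘ((a₁, a₂, z); (e₁, e₂ + 1, 1))` and `f = (t⁻¹)ᵃ g` in `B`, then
`g/1 ∈ 𝔪_{B_𝔫}^{m - a}`. [cite: AbramovichQuekSchober2025, Thm 1.3 (3), §5] -/
theorem mem_pow_of_mem_steepened [hP : (Ideal.span (Set.range ![y, x])).IsPrime]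
    (hzP : z ∉ Ideal.span (Set.range ![y, x]))
    {ρ : extReesAlgebra (weightedMonomialIdeal ![y, x] w) →+*
      MvPolynomial (Fin 2) (S ⧸ Ideal.span (Set.range ![y, x]))}
    (hρker : RingHom.ker ρ = Ideal.span {extReesAlgebra.tInv (weightedMonomialIdeal ![y, x] w)})
    (hρC : ∀ a : S, ρ (algebraMap S _ a) = MvPolynomial.C (Ideal.Quotient.mk _ a))
    {κ : Type} [Field κ] {ρ₀ : extReesAlgebra (weightedMonomialIdeal ![y, x] w) →+* MvPolynomial (Fin 2) κ}
    (hρ₀s : Function.Surjective ρ₀)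
    (hρ₀ker : RingHom.ker ρ₀ = Ideal.span {extReesAlgebra.tInv (weightedMonomialIdeal ![y, x] w),
      algebraMap S _ z})
    {a₁ a₂ : S} {e₁ e₂ : ℕ} {V₁ W : extReesAlgebra (weightedMonomialIdeal ![y, x] w)}
    (hV₁ : algebraMap S _ a₁ = extReesAlgebra.tInv (weightedMonomialIdeal ![y, x] w) ^ e₁ * V₁)
    (hW₂ : algebraMap S _ a₂ = extReesAlgebra.tInv (weightedMonomialIdeal ![y, x] w) ^ e₂ * W)
    {i j : Fin 2} (hij : i ≠ j) {μ : κ} {r : ℕ}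
    (hW : ρ₀ W = MvPolynomial.X i - MvPolynomial.C μ * MvPolynomial.X j ^ r)
    (𝔫 : Ideal (extReesAlgebra (weightedMonomialIdeal ![y, x] w))) [𝔫.IsPrime]
    (hT : extReesAlgebra.tInv (weightedMonomialIdeal ![y, x] w) ∈ 𝔫) (hz : algebraMap S _ z ∈ 𝔫) (hW𝔫 : W ∈ 𝔫)
    {f : S} {m : ℕ} (hf : f ∈ weightedMonomialIdeal ![a₁, a₂, z] ![e₁, e₂ + 1, 1] m)
    {a : ℕ} {g : extReesAlgebra (weightedMonomialIdeal ![y, x] w)}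
    (hfg : algebraMap S _ f = extReesAlgebra.tInv (weightedMonomialIdeal ![y, x] w) ^ a * g) :
    algebraMap _ (Localization.AtPrime 𝔫) g ∈ maximalIdeal (Localization.AtPrime 𝔫) ^ (m - a) := by
  classical
  -- `B_𝔫` is regular with regular system of parameters `(t⁻¹, z, W[, p̃])`
  obtain ⟨k, v, h0, h1, h2, -, hv0, -, -, -, hreg, hdimk, hvmax⟩ :=
    exists_rsp_of_mem (w := w) hzP hρker hρC hρ₀s hρ₀ker hij hW 𝔫 hT hz hW𝔫
  haveI := hreg
  have hmaxmem : ∀ b ∈ 𝔫, algebraMap _ (Localization.AtPrime 𝔫) b ∈ maximalIdeal (Localization.AtPrime 𝔫) :=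
    fun b hb => by rw [← Localization.AtPrime.map_eq_maximalIdeal]; exact Ideal.mem_map_of_mem _ hb
  -- push the steepened membership of `f` into `𝔪_{B_𝔫}^m`
  obtain ⟨φ, hφ⟩ : ∃ φ : S →+* Localization.AtPrime 𝔫, φ =
      (algebraMap _ (Localization.AtPrime 𝔫)).comp (algebraMap S (extReesAlgebra (weightedMonomialIdeal ![y, x] w))) :=
    ⟨_, rfl⟩
  have hφa₁ : φ a₁ = algebraMap _ (Localization.AtPrime 𝔫) (extReesAlgebra.tInv (weightedMonomialIdeal ![y, x] w)) ^ e₁ *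
      algebraMap _ (Localization.AtPrime 𝔫) V₁ := by
    rw [hφ, RingHom.comp_apply, hV₁, map_mul, map_pow]
  have hφa₂ : φ a₂ = algebraMap _ (Localization.AtPrime 𝔫) (extReesAlgebra.tInv (weightedMonomialIdeal ![y, x] w)) ^ e₂ *
      algebraMap _ (Localization.AtPrime 𝔫) W := by
    rw [hφ, RingHom.comp_apply, hW₂, map_mul, map_pow]
  have hφz : φ z = algebraMap _ (Localization.AtPrime 𝔫)
      (algebraMap S (extReesAlgebra (weightedMonomialIdeal ![y, x] w)) z) := by
    rw [hφ, RingHom.comp_apply]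
  have hTL : algebraMap _ (Localization.AtPrime 𝔫) (extReesAlgebra.tInv (weightedMonomialIdeal ![y, x] w)) ∈
      maximalIdeal (Localization.AtPrime 𝔫) := hmaxmem _ hT
  have hWL : algebraMap _ (Localization.AtPrime 𝔫) W ∈ maximalIdeal (Localization.AtPrime 𝔫) := hmaxmem _ hW𝔫
  have hzL : φ z ∈ maximalIdeal (Localization.AtPrime 𝔫) := by rw [hφz]; exact hmaxmem _ hz
  have hfm : φ f ∈ maximalIdeal (Localization.AtPrime 𝔫) ^ m :=
    map_mem_pow_of_mem_steepened (B := Localization.AtPrime 𝔫) φ (a₁ := a₁) (a₂ := a₂) (z := z) (e₁ := e₁) (e₂ := e₂)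
      hφa₁ hφa₂ (maximalIdeal (Localization.AtPrime 𝔫)) hTL hzL hWL (m := m) hf
  have hφf : φ f = algebraMap _ (Localization.AtPrime 𝔫) (extReesAlgebra.tInv (weightedMonomialIdeal ![y, x] w)) ^ a *
      algebraMap _ (Localization.AtPrime 𝔫) g := by
    rw [hφ, RingHom.comp_apply, hfg, map_mul, map_pow]
  rw [hφf] at hfm
  -- `t⁻¹/1` is a regular parameter of `B_𝔫`
  have hv0' : v ⟨0, h0⟩ = extReesAlgebra.tInv (weightedMonomialIdeal ![y, x] w) := hv0
  have hT2 : algebraMap _ (Localization.AtPrime 𝔫) (extReesAlgebra.tInv (weightedMonomialIdeal ![y, x] w)) ∉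
      maximalIdeal (Localization.AtPrime 𝔫) ^ 2 := by
    have h := not_mem_sq_of_span_range_eq (fun l => algebraMap _ (Localization.AtPrime 𝔫) (v l)) hvmax hdimk ⟨0, h0⟩
    simp only [hv0'] at h
    exact h
  refine mem_pow_sub_of_pow_mul_mem (L := Localization.AtPrime 𝔫)
    (t := algebraMap _ (Localization.AtPrime 𝔫) (extReesAlgebra.tInv (weightedMonomialIdeal ![y, x] w)))
    (g := algebraMap _ (Localization.AtPrime 𝔫) g) (a := a) (m := m) ?_ ?_ ?_
  · exact hTL
  · exact hT2
  · exact hfm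
end LemmaB'

/-! ## §4 The generic point of the tie curve, and where the tie curve lies -/
section TieCurve
variable {S : Type} [CommRing S] {y x z : S} {w : Fin 2 → ℕ}
/-- **The generic point of the tie curve is a successor off `Xⱼ = 0`.**  With `ρ₀ : B ↠ κ[X₀, X₁]` (`κ` a field) killing
`t⁻¹` and `z`, `ρ₀ (uₗ t^{wₗ}) = Xₗ`, and `ρ₀ W = Xᵢ - μ Xⱼ^r` (`i ≠ j`): the kernel `𝔫₀` of `B ↠ κ[X₀, X₁] ↠ κ[X]`
(`Xᵢ ↦ μX^r`, `Xⱼ ↦ X`, res-type-092's `exists_killVar`) is a prime of `B` containing `t⁻¹, z, W` and NOT `Xⱼ` (so it is off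
the vertex). [cite: Wlodarczyk2022, §2.3.9] -/
theorem exists_prime_tieCurve {κ : Type} [Field κ]
    {ρ₀ : extReesAlgebra (weightedMonomialIdeal ![y, x] w) →+* MvPolynomial (Fin 2) κ}
    (hρ₀ker : RingHom.ker ρ₀ = Ideal.span {extReesAlgebra.tInv (weightedMonomialIdeal ![y, x] w),
      algebraMap S _ z})
    (hX : ∀ i, ρ₀ (LocalGameEFTPointMove.uT ![y, x] w i) = MvPolynomial.X i)
    {W : extReesAlgebra (weightedMonomialIdeal ![y, x] w)} {i j : Fin 2} (hij : i ≠ j) {μ : κ} {r : ℕ}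
    (hW : ρ₀ W = MvPolynomial.X i - MvPolynomial.C μ * MvPolynomial.X j ^ r) :
    ∃ 𝔫 : PrimeSpectrum (extReesAlgebra (weightedMonomialIdeal ![y, x] w)),
      extReesAlgebra.tInv (weightedMonomialIdeal ![y, x] w) ∈ 𝔫.asIdeal ∧ algebraMap S _ z ∈ 𝔫.asIdeal ∧
      W ∈ 𝔫.asIdeal ∧ LocalGameEFTPointMove.uT ![y, x] w j ∉ 𝔫.asIdeal := by
  classical
  obtain ⟨φ, -, -, hφj, hφi, hφC⟩ := exists_killVar (κ := κ) i j hij μ r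
  haveI : (RingHom.ker (φ.comp ρ₀)).IsPrime := RingHom.ker_isPrime _
  have hker : ∀ b, b ∈ RingHom.ker ρ₀ → b ∈ RingHom.ker (φ.comp ρ₀) := fun b hb => by
    rw [RingHom.mem_ker] at hb
    rw [RingHom.mem_ker, RingHom.comp_apply, hb, map_zero]
  have hTk : extReesAlgebra.tInv (weightedMonomialIdeal ![y, x] w) ∈ RingHom.ker ρ₀ :=
    hρ₀ker ▸ Ideal.subset_span (Set.mem_insert _ _)
  have hzk : algebraMap S _ z ∈ RingHom.ker ρ₀ :=
    hρ₀ker ▸ Ideal.subset_span (Set.mem_insert_of_mem _ (Set.mem_singleton _))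
  refine ⟨⟨RingHom.ker (φ.comp ρ₀), inferInstance⟩, hker _ hTk, hker _ hzk, ?_, ?_⟩
  · rw [RingHom.mem_ker, RingHom.comp_apply, hW, map_sub, map_mul, map_pow, hφi, hφj, hφC, sub_self]
  · rw [RingHom.mem_ker, RingHom.comp_apply, hX, hφj]
    exact Polynomial.X_ne_zero

/-- **The tie curve lies over the closed point.**  `(a₁, a₂, z)` a regular system of parameters of `S` with
`a₁ = (t⁻¹)^{e₁} V₁` (`e₁ ≥ 1`), `a₂ = (t⁻¹)^{e₂} W` in `B`: every prime `𝔫 ∋ t⁻¹, z, W` of `B` contracts to `𝔪_S`.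
[cite: Wlodarczyk2022, §2.3.9] -/
theorem comap_eq_maximalIdeal_of_mem [IsLocalRing S] {a₁ a₂ : S}
    (ha : Ideal.span (Set.range ![a₁, a₂, z]) = maximalIdeal S) {e₁ e₂ : ℕ} (he₁ : 0 < e₁)
    {V₁ W : extReesAlgebra (weightedMonomialIdeal ![y, x] w)}
    (hV₁ : algebraMap S _ a₁ = extReesAlgebra.tInv (weightedMonomialIdeal ![y, x] w) ^ e₁ * V₁)
    (hW₂ : algebraMap S _ a₂ = extReesAlgebra.tInv (weightedMonomialIdeal ![y, x] w) ^ e₂ * W)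
    (𝔫 : Ideal (extReesAlgebra (weightedMonomialIdeal ![y, x] w))) [𝔫.IsPrime]
    (hT : extReesAlgebra.tInv (weightedMonomialIdeal ![y, x] w) ∈ 𝔫) (hz : algebraMap S _ z ∈ 𝔫) (hW𝔫 : W ∈ 𝔫) :
    𝔫.comap (algebraMap S (extReesAlgebra (weightedMonomialIdeal ![y, x] w))) = maximalIdeal S := by
  refine ((IsLocalRing.maximalIdeal.isMaximal S).eq_of_le (Ideal.comap_ne_top _ Ideal.IsPrime.ne_top') ?_).symm
  rw [← ha, Ideal.span_le]
  rintro _ ⟨l, rfl⟩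
  rw [SetLike.mem_coe, Ideal.mem_comap]
  fin_cases l
  · change algebraMap S _ a₁ ∈ 𝔫
    rw [hV₁, ← Nat.sub_add_cancel he₁, pow_succ, mul_assoc]
    exact Ideal.mul_mem_left _ _ (Ideal.mul_mem_right _ _ hT)
  · change algebraMap S _ a₂ ∈ 𝔫
    rw [hW₂]
    exact Ideal.mul_mem_left _ _ hW𝔫
  · exact hz
end TieCurve

/-! ## §5 The P3a tie presentation: TIE ⇒ a no-drop successor over the closed point -/
section Tie
variable {S : Type} [CommRing S] [IsRegularLocalRing S] {y x z : S} {r q : ℕ}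
/-- **TIE ⇒ NO-DROP SUCCESSOR** (converse of res-type-092's `notMem_pow_transform_of_tieFree`).  `S` regular local with regular
system of parameters `(y, x, z)` (`spanFinrank 𝔪 = 3`), `P = (y, x)` prime, weights `0 < q ≤ r` on `(y, x)`,
`B = S[t⁻¹, 𝒥ₙ((y,x);(r,q)) tⁿ]`.  If `f ∈ 𝒥_{(r+1)ν}((x, y - λx^r, z); (q, r+1, 1))` (the tie membership of
`Iota3.IsTiePresentation`) and `f = (t⁻¹)^{rν} g` in `B`, then there is a prime `𝔫` of `B` with `t⁻¹, z ∈ 𝔫`, `X = x t^q ∉ 𝔫`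
(off the vertex), `𝔫 ∩ S = 𝔪_S`, and `g/1 ∈ 𝔪_{B_𝔫}^ν` — the order of the transform does NOT drop below `ν` at `𝔫` (the generic
point of the tie curve `Y - λ (t⁻¹)^{r(q-1)} X^r = 0` of the special fibre). [cite: AbramovichQuekSchober2025, Thm 1.3 (3), §5] -/
theorem exists_successor_mem_pow_of_tie (hyxz : Ideal.span (Set.range ![y, x, z]) = maximalIdeal S)
    (hd : (maximalIdeal S).spanFinrank = 3) [hP : (Ideal.span (Set.range ![y, x])).IsPrime]
    (hq : 0 < q) (hqr : q ≤ r) {ν : ℕ} {f lam : S}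
    (htie : f ∈ weightedMonomialIdeal ![x, y - lam * x ^ r, z] ![q, r + 1, 1] ((r + 1) * ν))
    {g : extReesAlgebra (weightedMonomialIdeal ![y, x] ![r, q])}
    (hfg : algebraMap S _ f = extReesAlgebra.tInv (weightedMonomialIdeal ![y, x] ![r, q]) ^ (r * ν) * g) :
    ∃ 𝔫 : PrimeSpectrum (extReesAlgebra (weightedMonomialIdeal ![y, x] ![r, q])),
      extReesAlgebra.tInv (weightedMonomialIdeal ![y, x] ![r, q]) ∈ 𝔫.asIdeal ∧ algebraMap S _ z ∈ 𝔫.asIdeal ∧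
      LocalGameEFTPointMove.uT ![y, x] ![r, q] 1 ∉ 𝔫.asIdeal ∧
      𝔫.asIdeal.comap (algebraMap S (extReesAlgebra (weightedMonomialIdeal ![y, x] ![r, q]))) = maximalIdeal S ∧
      algebraMap _ (Localization.AtPrime 𝔫.asIdeal) g ∈ maximalIdeal (Localization.AtPrime 𝔫.asIdeal) ^ ν := by
  classical
  have hr : 0 < r := lt_of_lt_of_le hq hqr
  have hw : ∀ i, 0 < (![r, q] : Fin 2 → ℕ) i := by
    intro i; fin_cases i
    · exact hr
    · exact hq
  have hzP : z ∉ Ideal.span (Set.range ![y, x]) := notMem_span_pair hyxz hd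
  obtain ⟨ρ, -, hρker, -, hρC, -⟩ := LocalGameEFTPointMove.exists_rhoPartial ![y, x] ![r, q] hw
    (mem_maximalIdeal_pair hyxz) (linearIndependent_toCotangent_pair hyxz hd)
  obtain ⟨ρ₀, hρ₀s, hρ₀ker, hX, hC, hT0⟩ := exists_rhoZero hyxz hd ![r, q] hw
  -- the tie curve `W = Y - λ (t⁻¹)^{r(q-1)} X^r`
  obtain ⟨W, hWdef⟩ : ∃ W : extReesAlgebra (weightedMonomialIdeal ![y, x] ![r, q]),
      W = LocalGameEFTPointMove.uT ![y, x] ![r, q] 0 - algebraMap S _ lam *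
        extReesAlgebra.tInv (weightedMonomialIdeal ![y, x] ![r, q]) ^ (r * (q - 1)) *
          LocalGameEFTPointMove.uT ![y, x] ![r, q] 1 ^ r := ⟨_, rfl⟩
  have hW : ρ₀ W = MvPolynomial.X 0 - MvPolynomial.C (residue S lam * 0 ^ (r * (q - 1))) * MvPolynomial.X 1 ^ r := by
    simp only [hWdef, map_sub, map_mul, map_pow, hX, hC, hT0, MvPolynomial.C_0]
  have hV₁ : algebraMap S (extReesAlgebra (weightedMonomialIdeal ![y, x] ![r, q])) x =
      extReesAlgebra.tInv (weightedMonomialIdeal ![y, x] ![r, q]) ^ q * LocalGameEFTPointMove.uT ![y, x] ![r, q] 1 :=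
    algebraMap_x_eq
  have hW₂ : algebraMap S (extReesAlgebra (weightedMonomialIdeal ![y, x] ![r, q])) (y - lam * x ^ r) =
      extReesAlgebra.tInv (weightedMonomialIdeal ![y, x] ![r, q]) ^ r * W := by
    have hqr' : q * r = r + r * (q - 1) := by
      cases q with
      | zero => exact absurd hq (lt_irrefl 0)
      | succ q' => rw [Nat.add_sub_cancel]; ring
    rw [hWdef, map_sub, map_mul, map_pow, algebraMap_y_eq, algebraMap_x_eq, mul_pow, ← pow_mul, hqr', pow_add]
    ring
  obtain ⟨𝔫, hT, hz, hW𝔫, hX1⟩ := exists_prime_tieCurve hρ₀ker hX (W := W) Fin.zero_ne_one hW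
  have ha : Ideal.span (Set.range ![x, y - lam * x ^ r, z]) = maximalIdeal S := by
    rw [span_range_steepen _ _ _ _ hr, hyxz]
  refine ⟨𝔫, hT, hz, hX1, comap_eq_maximalIdeal_of_mem ha hq hV₁ hW₂ 𝔫.asIdeal hT hz hW𝔫, ?_⟩
  have h := mem_pow_of_mem_steepened hzP hρker hρC hρ₀s hρ₀ker hV₁ hW₂ Fin.zero_ne_one hW 𝔫.asIdeal hT hz hW𝔫
    htie hfg
  have hsub : (r + 1) * ν - r * ν = ν := by rw [add_mul, one_mul, Nat.add_sub_cancel_left]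
  rw [hsub] at h
  exact h

/-- **TIE on the `X = 0` curve ⇒ NO-DROP SUCCESSOR** (`q = r = 1`; converse of res-type-092's `notMem_pow_of_X_mem`): if
`f ∈ 𝒥_{2ν}((y, x, z); (1, 2, 1))` and `f = (t⁻¹)^{ν} g`, then there is a prime `𝔫 ∋ t⁻¹, z` with `Y ∉ 𝔫`, `𝔫 ∩ S = 𝔪_S`
and `g/1 ∈ 𝔪_{B_𝔫}^ν`. [cite: AbramovichQuekSchober2025, Thm 1.3 (3), §5] -/
theorem exists_successor_mem_pow_of_tie_swap (hyxz : Ideal.span (Set.range ![y, x, z]) = maximalIdeal S)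
    (hd : (maximalIdeal S).spanFinrank = 3) [hP : (Ideal.span (Set.range ![y, x])).IsPrime]
    (hq1 : q = 1) (hr1 : r = 1) {ν : ℕ} {f : S}
    (htie : f ∈ weightedMonomialIdeal ![y, x, z] ![1, 2, 1] (2 * ν))
    {g : extReesAlgebra (weightedMonomialIdeal ![y, x] ![r, q])}
    (hfg : algebraMap S _ f = extReesAlgebra.tInv (weightedMonomialIdeal ![y, x] ![r, q]) ^ (r * ν) * g) :
    ∃ 𝔫 : PrimeSpectrum (extReesAlgebra (weightedMonomialIdeal ![y, x] ![r, q])),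
      extReesAlgebra.tInv (weightedMonomialIdeal ![y, x] ![r, q]) ∈ 𝔫.asIdeal ∧ algebraMap S _ z ∈ 𝔫.asIdeal ∧
      LocalGameEFTPointMove.uT ![y, x] ![r, q] 0 ∉ 𝔫.asIdeal ∧
      𝔫.asIdeal.comap (algebraMap S (extReesAlgebra (weightedMonomialIdeal ![y, x] ![r, q]))) = maximalIdeal S ∧
      algebraMap _ (Localization.AtPrime 𝔫.asIdeal) g ∈ maximalIdeal (Localization.AtPrime 𝔫.asIdeal) ^ ν := by
  classical
  subst hq1 hr1
  have hw : ∀ i, 0 < (![1, 1] : Fin 2 → ℕ) i := by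
    intro i; fin_cases i
    · exact one_pos
    · exact one_pos
  have hzP : z ∉ Ideal.span (Set.range ![y, x]) := notMem_span_pair hyxz hd
  obtain ⟨ρ, -, hρker, -, hρC, -⟩ := LocalGameEFTPointMove.exists_rhoPartial ![y, x] ![1, 1] hw
    (mem_maximalIdeal_pair hyxz) (linearIndependent_toCotangent_pair hyxz hd)
  obtain ⟨ρ₀, hρ₀s, hρ₀ker, hX, -, -⟩ := exists_rhoZero hyxz hd ![1, 1] hw
  have hW : ρ₀ (LocalGameEFTPointMove.uT ![y, x] ![1, 1] 1) =
      MvPolynomial.X 1 - MvPolynomial.C (0 : ResidueField S) * MvPolynomial.X 0 ^ 1 := by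
    rw [hX, map_zero, zero_mul, sub_zero]
  have h10 : (1 : Fin 2) ≠ 0 := Fin.zero_ne_one.symm
  obtain ⟨𝔫, hT, hz, hW𝔫, hX0⟩ := exists_prime_tieCurve hρ₀ker hX h10 hW
  refine ⟨𝔫, hT, hz, hX0, comap_eq_maximalIdeal_of_mem hyxz one_pos algebraMap_y_eq algebraMap_x_eq 𝔫.asIdeal hT hz hW𝔫, ?_⟩
  have h := mem_pow_of_mem_steepened hzP hρker hρC hρ₀s hρ₀ker algebraMap_y_eq algebraMap_x_eq h10 hW 𝔫.asIdeal hT hz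
    hW𝔫 htie hfg
  have hsub : 2 * ν - 1 * ν = ν := by omega
  rw [hsub] at h
  exact h
end Tie
end TieFinite

/-! ## §6 Read off `Iota3.IsTiePresentation` -/
namespace Iota3
/-- **A TIE PRESENTATION PRODUCES A NO-DROP SUCCESSOR OVER THE CLOSED POINT** — the shape the in-chart Chevalley step of the
finiteness of the tie points consumes: for `Iota3.IsTiePresentation S f x y z q r lam` (res-type-092, `…Iota3Tie`) at a regular
local `S` of dimension `3`, with `f ∈ 𝔪^ν ∖ 𝔪^{ν+1}` and `f = (t⁻¹)^{rν} g` in the cylinder move `B = S[t⁻¹, 𝒥ₙ((y,x);(r,q)) tⁿ]`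
of record, some prime `𝔫 ∋ t⁻¹, z` of `B` over `𝔪_S` with `X ∉ 𝔫` has `g/1 ∈ 𝔪_{B_𝔫}^ν`, i.e. `ν ≤ adicOrder (g/1)`.
[cite: AbramovichQuekSchober2025, Thm 1.3 (3), §5] -/
theorem IsTiePresentation.exists_successor_le_adicOrder {S : Type} [CommRing S] [IsRegularLocalRing S]
    {f x y z : S} {q r : ℕ} {lam : S} (h : IsTiePresentation S f x y z q r lam) (hdim : ringKrullDim S = 3) {ν : ℕ}
    (hfν : f ∈ maximalIdeal S ^ ν) (hfν' : f ∉ maximalIdeal S ^ (ν + 1))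
    {g : extReesAlgebra (weightedMonomialIdeal ![y, x] ![r, q])}
    (hfg : algebraMap S _ f = extReesAlgebra.tInv (weightedMonomialIdeal ![y, x] ![r, q]) ^ (r * ν) * g) :
    ∃ 𝔫 : PrimeSpectrum (extReesAlgebra (weightedMonomialIdeal ![y, x] ![r, q])),
      extReesAlgebra.tInv (weightedMonomialIdeal ![y, x] ![r, q]) ∈ 𝔫.asIdeal ∧ algebraMap S _ z ∈ 𝔫.asIdeal ∧
      LocalGameEFTPointMove.uT ![y, x] ![r, q] 1 ∉ 𝔫.asIdeal ∧
      𝔫.asIdeal.comap (algebraMap S (extReesAlgebra (weightedMonomialIdeal ![y, x] ![r, q]))) = maximalIdeal S ∧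
      algebraMap _ (Localization.AtPrime 𝔫.asIdeal) g ∈ maximalIdeal (Localization.AtPrime 𝔫.asIdeal) ^ ν ∧
      (ν : ℕ∞) ≤ adicOrder (algebraMap _ (Localization.AtPrime 𝔫.asIdeal) g) := by
  obtain ⟨hxyz, -, ν', hP, hν'1, hν'2, hlex, htie⟩ := h
  -- `ν' = ν`
  obtain rfl : ν = ν' := by
    by_contra hne
    rcases Nat.lt_or_gt_of_ne hne with hlt | hgt
    · exact hfν' (Ideal.pow_le_pow_right (by omega) hν'1)
    · exact hν'2 (Ideal.pow_le_pow_right (by omega) hfν)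
  have hyxz : Ideal.span (Set.range ![y, x, z]) = maximalIdeal S := by
    rw [← hxyz, Matrix.range_cons, Matrix.range_cons, Matrix.range_cons, Matrix.range_empty, Set.union_empty,
      Set.singleton_union, Set.singleton_union, Set.insert_comm y x]
  have hd : (maximalIdeal S).spanFinrank = 3 := by
    have h3 := IsRegularLocalRing.spanFinrank_maximalIdeal (R := S)
    rw [hdim] at h3
    exact_mod_cast h3
  haveI : (Ideal.span (Set.range ![y, x])).IsPrime := by
    rw [Matrix.range_cons, Matrix.range_cons, Matrix.range_empty, Set.union_empty, Set.singleton_union, Set.pair_comm]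
    exact hP
  have hq : 0 < q := by simpa using hlex.2.1 1
  have hqr : q ≤ r := by simpa using hlex.2.2.2.1
  obtain ⟨𝔫, hT, hz, hX1, hcomap, hmem⟩ := TieFinite.exists_successor_mem_pow_of_tie hyxz hd hq hqr htie hfg
  have h2 : (ν : ℕ∞) ≤ adicOrder (algebraMap _ (Localization.AtPrime 𝔫.asIdeal) g) := by
    rw [le_adicOrder_iff]; exact hmem
  exact ⟨𝔫, hT, hz, hX1, hcomap, hmem, h2⟩
end Iota3
end Summit.ResolutionOfSingularities.ResolutionOfSingularities.Cruxes.HypersurfaceCentreConstruction.LocalEngine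

end
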